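import Summits.MatrixMultiplication.MatrixMultiplication.Theses.CommutativeSchemes

/-!
# `CommutativeSchemes.Assembly` (stmt-MatrixMultiplication-9470) — commutative realisation, the
s-rank transfer and weight removal give `ω(ℂ) = 2`

Route `MatrixMultiplication/CommutativeSchemes`, item `stmt-MatrixMultiplication-9470` (assembly,
rank 1):

  `CommutativeRealization → RealizationSRank → WeightRemoval → MatrixMultiplication`.

This is, verbatim, the type of the route's kernel-checked deciding theorem
`Summit.MatrixMultiplication.MatrixMultiplication.Theses.CommutativeSchemes.closes`; the proof below
replays that bookkeeping against the literal route decl without depending on `closes` itself (so the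
file survives any later re-authoring of the deciding theorem's proof script).

Argument (Cohn–Umans 2013, §3–4, bookkeeping over the cone).  `2 ≤ ω(ℂ)` is the flattening bound
`omega_two_le`.  For the other inequality it suffices (`le_of_forall_pos_le_add`) to show
`ω(ℂ) ≤ 2 + δ` for every `δ > 0`.  Put `ε := 2δ/3 > 0`.  `CommutativeRealization` (CU13 Conj. 21,
ε-form) gives `n ≥ 2` and a commutative association scheme on a finite type `X` with `r ≤ n^(2+ε)`
classes realising `⟨n,n,n⟩` via injections `α, β, γ`.  `RealizationSRank` (CU13 Prop. 9) turns the
realisation into a tensor `t` with exactly the support of `matMulTensor ℂ n n n` and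
`tensorRank t ≤ r ≤ n^(2+ε)`.  `WeightRemoval` (CU13 Prop. 5 + Thm. 6) then gives
`ω(ℂ) ≤ 2 + (3/2)·ε = 2 + δ`.  Hence `ω(ℂ) = 2`, which is `MatrixMultiplication`
(`MatrixMultiplication_iff`).

References: H. Cohn, C. Umans, *Fast matrix multiplication using coherent configurations*,
SODA 2013 (arXiv:1207.6528), Prop. 5, Thm. 6, Prop. 9, Conj. 21; M. Bläser, *Fast Matrix
Multiplication*, Theory of Computing Graduate Surveys 5 (2013), Def. 5.1.
-/

-- single-conjunct summit: the mandated namespace `Summit.MatrixMultiplication.MatrixMultiplication.…`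
-- repeats `MatrixMultiplication` (summit = sub-problem), which `linter.dupNamespace` would flag.
set_option linter.dupNamespace false

namespace Summit.MatrixMultiplication.MatrixMultiplication.Theorems

open Summit.MatrixMultiplication.MatrixMultiplication.Theses.CommutativeSchemes in
/-- **Assembly of route CommutativeSchemes** (settles `stmt-MatrixMultiplication-9470`, exact route
signature `Summit.MatrixMultiplication.MatrixMultiplication.Theses.CommutativeSchemes.Assembly`):
commutative realisation of `⟨n,n,n⟩` at rank `n^(2+ε)` for every `ε > 0` (`CommutativeRealization`,
CU13 Conj. 21), the s-rank transfer (`RealizationSRank`, CU13 Prop. 9) and weight removal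
(`WeightRemoval`, CU13 Prop. 5 + Thm. 6) give `ω(ℂ) = 2`: for `δ > 0` take `ε = 2δ/3`, get a scheme
with `r ≤ n^(2+ε)` classes realising `⟨n,n,n⟩`, a tensor with the support of `⟨n,n,n⟩` and rank
`≤ r`, hence `ω(ℂ) ≤ 2 + (3/2)ε = 2 + δ`; `2 ≤ ω(ℂ)` is `omega_two_le`.  Same argument as the route's
deciding theorem `closes`, replayed here self-containedly.
[cite: CohnUmans2013, Prop. 5, Thm. 6, Prop. 9, Conj. 21] [cite: Blaser2013, Def. 5.1] -/
theorem commutativeSchemes_assembly_proof :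
    Summit.MatrixMultiplication.MatrixMultiplication.Theses.CommutativeSchemes.Assembly := by
  unfold Summit.MatrixMultiplication.MatrixMultiplication.Theses.CommutativeSchemes.Assembly
  intro hC hS hW
  rw [_root_.MatrixMultiplication_iff]
  apply le_antisymm _ (Literature.Computability.AlgebraicComplexity.omega_two_le ℂ)
  apply le_of_forall_pos_le_add
  intro δ hδ
  -- the target at ε = 2δ/3: a scheme with r ≤ n^(2+ε) classes realising ⟨n,n,n⟩
  obtain ⟨n, hn, X, hX, r, cls, hr, h1, h2, h3, α, β, γ, hreal⟩ := hC (2 / 3 * δ) (by positivity)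
  -- CU13 Prop. 9: a tensor with the support of ⟨n,n,n⟩ and rank ≤ r
  obtain ⟨t, ht, htr⟩ := @hS n X hX r cls h1 h2 h3 α β γ hreal
  -- CU13 Prop. 5 + Thm. 6: ω ≤ 2 + (3/2)ε
  have hw := hW (2 / 3 * δ) (by positivity) n hn ⟨t, ht, le_trans (by exact_mod_cast htr) hr⟩
  calc Literature.Computability.AlgebraicComplexity.omega ℂ ≤ 2 + 3 / 2 * (2 / 3 * δ) := hw
    _ = 2 + δ := by ring

end Summit.MatrixMultiplication.MatrixMultiplication.Theorems
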